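import Summits.CriticalPhenomena.PercolationContinuityZ3.Theorems.PercNearOneGluingNoHeavyLowerTailSahiTripartitionULC
import Mathlib
import HarnessLib
import HarnessLib.Audit.Tags

/-!
# `NoHeavyLowerTail` (crux stmt-CriticalPhenomena-4575), master-family line P1 (gen 19):
# REFUTATION of the TRIPARTITION ULC LEMMA-CANDIDATE (`UnateTripartitionULC`, `UnateTripartitionRealRooted`)

Support file (seat `prim-masterthm-p1`, gen 19; `--supports stmt-CriticalPhenomena-4575`), on top of the tree's `…SahiTripartitionULC`
(gen 17: `triCount`, `nParts`, the typed conjectures).  Memo `run/shared/lean/prim/prim-masterthm/FROM-prim-masterthm-p1-g19-ULC-REFUTATION.md`.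

THE WITNESS (nine points, MONOTONE, no twist).  Ground set `Fin 9` with blocks `P = {0,1,2}`, `Q = {3,4,5}`, `R = {6,7,8}`;
`u x = true` iff `x ⊇ P` or `x ⊇ Q` or `x ⊇ R` or (`0 ∈ x` and `x ∩ Q ≠ ∅` and `x ∩ R ≠ ∅`) — the three blocks plus the STAR OF
TRANSVERSALS through `0` (`cexU9`).  Its ordered-tripartition cell counts are `(n₀,n₁,n₂,n₃) = (6048, 13179, 450, 6)`
(`nParts_cexU9_zero/one/two/three`), so `3·n₁·n₃ = 237222 > 202500 = n₂²`: the number `N` of cells lying in `u` is NOT ultra-log-concave,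
equivalently (memo g17 §1) given `Z ∈ u` the events `X ∈ u`, `Y ∈ u` are POSITIVELY correlated (`#XYZ·#Z = 28194 > 24336 = #XZ·#YZ`), and the
cubic `n₀ + n₁t + n₂t² + n₃t³` has discriminant `−18131086461924 < 0` (a pair of non-real roots).  MECHANISM ("lonely blocks", a Yule–Simpson
mixture): the only tripartition with three member cells is `P|Q|R`; a star member (contains `0`, meets `Q` and `R`) never coexists with a disjoint
member, so given `Z ∈ u` the cell `Z` is mostly a star member (then `X, Y ∉ u` together) and rarely a block (then `X, Y` have a chance together).
The family `(|P|,|Q|,|R|) = (l,l,l)` gives `3n₁n₃/n₂² ≈ 3^l/18 → ∞`; `(2,2,2)` on six points is exactly the extremiser of the exhaustive 6-point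
census (ratio `0.5408`), which is why every census through 6 points was clean.
KERNEL TECHNIQUE.  `nParts u c = Σ_x cnt u c x` (`rfl`); the outer sum over the `512` first cells is split into 17 classes by the membership
pattern of `x` on `{0,1,2,3}` (and `4` for the all-absent class) — `cls`, `sum_cls_cons` — each class sum of the packed 4-vector `cnt4` is a
`decide +kernel` evaluation of at most `2592` inner cells (the unsplit `3⁹`-term evaluation exceeds the kernel memory guard), and the classes are
re-assembled by rewriting.
CONSEQUENCES.  FALSE: `UnateTripartitionULC` (`not_unateTripartitionULC`), `UnateTripartitionRealRooted` (`not_unateTripartitionRealRooted`), hence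
the CHAIN / GRADED polarisations of gen 18 (they imply Half A), the "function version", and the route "LC-EXMAX at block statistics ⟹
PivotDichotomy on composites" (block statistics of monotone blocks need NOT be log-concave: here `b² = 150² < 4393·6 = a·g`).  NOT touched: the
degree-1 member `triCount_and_mul_le` (negative correlation of two cells, a theorem), Half B in the pure model (`3n₀n₂ ≤ n₁²`, open), `PivotDichotomy`,
S₃^max, CP3⁺, S₃, the class law.
HONEST FRAMING: a kernel refutation of two typed conjectures of this line. [this work]
-/

namespace Summit.CriticalPhenomena.PercolationContinuityZ3.Theorems

namespace SahiTripartition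

open Finset

/-! ### 1. The witness and its monotonicity -/

/-- **The 9-point witness** `cexU9`: blocks `{0,1,2}`, `{3,4,5}`, `{6,7,8}` and the star of transversals through `0`
(`0 ∈ x`, `x` meets `{3,4,5}` and `{6,7,8}`). [this work] -/
def cexU9 (x : Finset (Fin 9)) : Bool :=
  (decide (0 ∈ x) && decide (1 ∈ x) && decide (2 ∈ x)) || (decide (3 ∈ x) && decide (4 ∈ x) && decide (5 ∈ x)) ||
    (decide (6 ∈ x) && decide (7 ∈ x) && decide (8 ∈ x)) ||
    (decide (0 ∈ x) && (decide (3 ∈ x) || decide (4 ∈ x) || decide (5 ∈ x)) && (decide (6 ∈ x) || decide (7 ∈ x) || decide (8 ∈ x)))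

/-- `cexU9` is monotone (an up-set: it is built from membership tests by `&&` and `||` only). [this work] -/
theorem cexU9_mono : Monotone cexU9 := by
  intro x y hxy
  have h : ∀ i : Fin 9, decide (i ∈ x) = true → decide (i ∈ y) = true := fun i hi => by
    rw [decide_eq_true_eq] at hi ⊢; exact hxy hi
  show cexU9 x ≤ cexU9 y
  rcases hx : cexU9 x with _ | _
  · exact Bool.false_le _
  · rw [cexU9, Bool.or_eq_true, Bool.or_eq_true, Bool.or_eq_true] at hx
    have hy : cexU9 y = true := by
      rw [cexU9, Bool.or_eq_true, Bool.or_eq_true, Bool.or_eq_true]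
      simp only [Bool.and_eq_true, Bool.or_eq_true] at hx ⊢
      rcases hx with ((⟨⟨h0, h1⟩, h2⟩ | ⟨⟨h3, h4⟩, h5⟩) | ⟨⟨h6, h7⟩, h8⟩) | ⟨⟨h0, hq⟩, hr⟩
      · exact Or.inl (Or.inl (Or.inl ⟨⟨h 0 h0, h 1 h1⟩, h 2 h2⟩))
      · exact Or.inl (Or.inl (Or.inr ⟨⟨h 3 h3, h 4 h4⟩, h 5 h5⟩))
      · exact Or.inl (Or.inr ⟨⟨h 6 h6, h 7 h7⟩, h 8 h8⟩)
      · refine Or.inr ⟨⟨h 0 h0, ?_⟩, ?_⟩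
        · rcases hq with (hq | hq) | hq
          · exact Or.inl (Or.inl (h 3 hq))
          · exact Or.inl (Or.inr (h 4 hq))
          · exact Or.inr (h 5 hq)
        · rcases hr with (hr | hr) | hr
          · exact Or.inl (Or.inl (h 6 hr))
          · exact Or.inl (Or.inr (h 7 hr))
          · exact Or.inr (h 8 hr)
    rw [hy]

/-- The form the conjectures quantify over (twist `t = ∅`). [this work] -/
theorem cexU9_mono_symmDiff : Monotone (fun x => cexU9 (symmDiff x ∅)) := by
  intro x y hxy
  show cexU9 (symmDiff x ∅) ≤ cexU9 (symmDiff y ∅)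
  rw [show (∅ : Finset (Fin 9)) = ⊥ from rfl, symmDiff_bot, symmDiff_bot]
  exact cexU9_mono hxy

/-! ### 2. The summand of `nParts`, packed, and the class decomposition of the outer sum -/

/-- The summand of `triCount`/`nParts` at the first cell `x`, for cell-count `c`. [this work] -/
def cnt (u : Finset (Fin 9) → Bool) (c : ℕ) (x : Finset (Fin 9)) : ℕ :=
  ((xᶜ.powerset).filter fun y => ((u x).toNat + (u y).toNat + (u (xᶜ \ y)).toNat == c) = true).card

/-- `nParts u c` is the sum of `cnt u c` over the first cell (definitional). [this work] -/
theorem nParts_eq_sum_cnt (u : Finset (Fin 9) → Bool) (c : ℕ) : nParts u c = ∑ x, cnt u c x := rfl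

/-- The four summands packed into `ℕ × ℕ × ℕ × ℕ`. [this work] -/
def cnt4 (u : Finset (Fin 9) → Bool) (x : Finset (Fin 9)) : ℕ × ℕ × ℕ × ℕ := (cnt u 0 x, cnt u 1 x, cnt u 2 x, cnt u 3 x)

/-- The class of first cells with a prescribed membership pattern (a list of (point, required membership)). [this work] -/
def cls (l : List (Fin 9 × Bool)) : Finset (Finset (Fin 9)) :=
  univ.filter fun x => ∀ p ∈ l, (p.1 ∈ x ↔ p.2 = true)

/-- The empty pattern is the whole cube. [this work] -/
theorem cls_nil : cls [] = (univ : Finset (Finset (Fin 9))) := by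
  ext x; simp [cls]

/-- Splitting a class by the membership of one more point. [this work] -/
theorem sum_cls_cons {M : Type*} [AddCommMonoid M] (l : List (Fin 9 × Bool)) (i : Fin 9) (f : Finset (Fin 9) → M) :
    ∑ x ∈ cls l, f x = ∑ x ∈ cls ((i, true) :: l), f x + ∑ x ∈ cls ((i, false) :: l), f x := by
  rw [← sum_filter_add_sum_filter_not (cls l) (fun x => i ∈ x) f]
  congr 1
  · congr 1; ext x; simp only [cls, mem_filter, mem_univ, true_and, List.forall_mem_cons]; tauto
  · congr 1; ext x
    simp only [cls, mem_filter, mem_univ, true_and, List.forall_mem_cons, Bool.false_eq_true, iff_false]; tauto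

/-! ### 3. Kernel evaluation of the 17 class sums (each ≤ 2592 inner cells; `decide +kernel`) -/

set_option maxRecDepth 1000000 in
set_option maxHeartbeats 4000000 in -- kernel evaluation of a class sum (243 inner cells; one-off certificate check)
/-- Class sum 1 (pattern `[(3, true), (2, true), (1, true), (0, true)]`, 243 inner cells). [this work] -/
theorem cls_sum_1 : ∑ x ∈ cls [(3, true), (2, true), (1, true), (0, true)], cnt4 cexU9 x = (0, 225, 18, 0) := by
  decide +kernel

set_option maxRecDepth 1000000 in
set_option maxHeartbeats 4000000 in -- kernel evaluation of a class sum (486 inner cells; one-off certificate check)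
/-- Class sum 2 (pattern `[(3, false), (2, true), (1, true), (0, true)]`, 486 inner cells). [this work] -/
theorem cls_sum_2 : ∑ x ∈ cls [(3, false), (2, true), (1, true), (0, true)], cnt4 cexU9 x = (0, 400, 84, 2) := by
  decide +kernel

set_option maxRecDepth 1000000 in
set_option maxHeartbeats 4000000 in -- kernel evaluation of a class sum (486 inner cells; one-off certificate check)
/-- Class sum 3 (pattern `[(3, true), (2, false), (1, true), (0, true)]`, 486 inner cells). [this work] -/
theorem cls_sum_3 : ∑ x ∈ cls [(3, true), (2, false), (1, true), (0, true)], cnt4 cexU9 x = (96, 386, 4, 0) := by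
  decide +kernel

set_option maxRecDepth 1000000 in
set_option maxHeartbeats 4000000 in -- kernel evaluation of a class sum (972 inner cells; one-off certificate check)
/-- Class sum 4 (pattern `[(3, false), (2, false), (1, true), (0, true)]`, 972 inner cells). [this work] -/
theorem cls_sum_4 : ∑ x ∈ cls [(3, false), (2, false), (1, true), (0, true)], cnt4 cexU9 x = (408, 556, 8, 0) := by
  decide +kernel

set_option maxRecDepth 1000000 in
set_option maxHeartbeats 4000000 in -- kernel evaluation of a class sum (486 inner cells; one-off certificate check)
/-- Class sum 5 (pattern `[(3, true), (2, true), (1, false), (0, true)]`, 486 inner cells). [this work] -/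
theorem cls_sum_5 : ∑ x ∈ cls [(3, true), (2, true), (1, false), (0, true)], cnt4 cexU9 x = (96, 386, 4, 0) := by
  decide +kernel

set_option maxRecDepth 1000000 in
set_option maxHeartbeats 4000000 in -- kernel evaluation of a class sum (972 inner cells; one-off certificate check)
/-- Class sum 6 (pattern `[(3, false), (2, true), (1, false), (0, true)]`, 972 inner cells). [this work] -/
theorem cls_sum_6 : ∑ x ∈ cls [(3, false), (2, true), (1, false), (0, true)], cnt4 cexU9 x = (408, 556, 8, 0) := by
  decide +kernel

set_option maxRecDepth 1000000 in
set_option maxHeartbeats 4000000 in -- kernel evaluation of a class sum (972 inner cells; one-off certificate check)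
/-- Class sum 7 (pattern `[(3, true), (2, false), (1, false), (0, true)]`, 972 inner cells). [this work] -/
theorem cls_sum_7 : ∑ x ∈ cls [(3, true), (2, false), (1, false), (0, true)], cnt4 cexU9 x = (192, 772, 8, 0) := by
  decide +kernel

set_option maxRecDepth 1000000 in
set_option maxHeartbeats 4000000 in -- kernel evaluation of a class sum (1944 inner cells; one-off certificate check)
/-- Class sum 8 (pattern `[(3, false), (2, false), (1, false), (0, true)]`, 1944 inner cells). [this work] -/
theorem cls_sum_8 : ∑ x ∈ cls [(3, false), (2, false), (1, false), (0, true)], cnt4 cexU9 x = (816, 1112, 16, 0) := by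
  decide +kernel

set_option maxRecDepth 1000000 in
set_option maxHeartbeats 4000000 in -- kernel evaluation of a class sum (486 inner cells; one-off certificate check)
/-- Class sum 9 (pattern `[(3, true), (2, true), (1, true), (0, false)]`, 486 inner cells). [this work] -/
theorem cls_sum_9 : ∑ x ∈ cls [(3, true), (2, true), (1, true), (0, false)], cnt4 cexU9 x = (204, 278, 4, 0) := by
  decide +kernel

set_option maxRecDepth 1000000 in
set_option maxHeartbeats 4000000 in -- kernel evaluation of a class sum (972 inner cells; one-off certificate check)
/-- Class sum 10 (pattern `[(3, false), (2, true), (1, true), (0, false)]`, 972 inner cells). [this work] -/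
theorem cls_sum_10 : ∑ x ∈ cls [(3, false), (2, true), (1, true), (0, false)], cnt4 cexU9 x = (300, 664, 8, 0) := by
  decide +kernel

set_option maxRecDepth 1000000 in
set_option maxHeartbeats 4000000 in -- kernel evaluation of a class sum (972 inner cells; one-off certificate check)
/-- Class sum 11 (pattern `[(3, true), (2, false), (1, true), (0, false)]`, 972 inner cells). [this work] -/
theorem cls_sum_11 : ∑ x ∈ cls [(3, true), (2, false), (1, true), (0, false)], cnt4 cexU9 x = (408, 556, 8, 0) := by
  decide +kernel

set_option maxRecDepth 1000000 in
set_option maxHeartbeats 4000000 in -- kernel evaluation of a class sum (1944 inner cells; one-off certificate check)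
/-- Class sum 12 (pattern `[(3, false), (2, false), (1, true), (0, false)]`, 1944 inner cells). [this work] -/
theorem cls_sum_12 : ∑ x ∈ cls [(3, false), (2, false), (1, true), (0, false)], cnt4 cexU9 x = (600, 1328, 16, 0) := by
  decide +kernel

set_option maxRecDepth 1000000 in
set_option maxHeartbeats 4000000 in -- kernel evaluation of a class sum (972 inner cells; one-off certificate check)
/-- Class sum 13 (pattern `[(3, true), (2, true), (1, false), (0, false)]`, 972 inner cells). [this work] -/
theorem cls_sum_13 : ∑ x ∈ cls [(3, true), (2, true), (1, false), (0, false)], cnt4 cexU9 x = (408, 556, 8, 0) := by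
  decide +kernel

set_option maxRecDepth 1000000 in
set_option maxHeartbeats 4000000 in -- kernel evaluation of a class sum (1944 inner cells; one-off certificate check)
/-- Class sum 14 (pattern `[(3, false), (2, true), (1, false), (0, false)]`, 1944 inner cells). [this work] -/
theorem cls_sum_14 : ∑ x ∈ cls [(3, false), (2, true), (1, false), (0, false)], cnt4 cexU9 x = (600, 1328, 16, 0) := by
  decide +kernel

set_option maxRecDepth 1000000 in
set_option maxHeartbeats 4000000 in -- kernel evaluation of a class sum (1944 inner cells; one-off certificate check)
/-- Class sum 15 (pattern `[(3, true), (2, false), (1, false), (0, false)]`, 1944 inner cells). [this work] -/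
theorem cls_sum_15 : ∑ x ∈ cls [(3, true), (2, false), (1, false), (0, false)], cnt4 cexU9 x = (612, 1234, 96, 2) := by
  decide +kernel

set_option maxRecDepth 1000000 in
set_option maxHeartbeats 4000000 in -- kernel evaluation of a class sum (1296 inner cells; one-off certificate check)
/-- Class sum 16 (pattern `[(4, true), (3, false), (2, false), (1, false), (0, false)]`, 1296 inner cells). [this work] -/
theorem cls_sum_16 : ∑ x ∈ cls [(4, true), (3, false), (2, false), (1, false), (0, false)], cnt4 cexU9 x = (432, 840, 24, 0) := by
  decide +kernel

set_option maxRecDepth 1000000 in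
set_option maxHeartbeats 4000000 in -- kernel evaluation of a class sum (2592 inner cells; one-off certificate check)
/-- Class sum 17 (pattern `[(4, false), (3, false), (2, false), (1, false), (0, false)]`, 2592 inner cells). [this work] -/
theorem cls_sum_17 : ∑ x ∈ cls [(4, false), (3, false), (2, false), (1, false), (0, false)], cnt4 cexU9 x = (468, 2002, 120, 2) := by
  decide +kernel

/-! ### 4. Re-assembly: the four cell counts of the witness -/

/-- `(n₀,n₁,n₂,n₃)(cexU9) = (6048, 13179, 450, 6)` as the packed sum. [this work] -/
theorem sum_cnt4_cexU9 : ∑ x, cnt4 cexU9 x = (6048, 13179, 450, 6) := by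
  rw [← cls_nil]
  rw [sum_cls_cons [] 0, sum_cls_cons [(0, true)] 1, sum_cls_cons [(1, true), (0, true)] 2, sum_cls_cons [(2, true), (1, true), (0, true)] 3, sum_cls_cons [(2, false), (1, true), (0, true)] 3, sum_cls_cons [(1, false), (0, true)] 2, sum_cls_cons [(2, true), (1, false), (0, true)] 3, sum_cls_cons [(2, false), (1, false), (0, true)] 3, sum_cls_cons [(0, false)] 1, sum_cls_cons [(1, true), (0, false)] 2, sum_cls_cons [(2, true), (1, true), (0, false)] 3, sum_cls_cons [(2, false), (1, true), (0, false)] 3, sum_cls_cons [(1, false), (0, false)] 2, sum_cls_cons [(2, true), (1, false), (0, false)] 3, sum_cls_cons [(2, false), (1, false), (0, false)] 3, sum_cls_cons [(3, false), (2, false), (1, false), (0, false)] 4]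
  rw [cls_sum_1, cls_sum_2, cls_sum_3, cls_sum_4, cls_sum_5, cls_sum_6, cls_sum_7, cls_sum_8, cls_sum_9, cls_sum_10, cls_sum_11, cls_sum_12, cls_sum_13, cls_sum_14, cls_sum_15, cls_sum_16, cls_sum_17]
  rfl

/-- `n₀ = 6048`. [this work] -/
theorem nParts_cexU9_zero : nParts cexU9 0 = 6048 := by
  rw [nParts_eq_sum_cnt]
  have h := congrArg Prod.fst sum_cnt4_cexU9
  rw [Prod.fst_sum] at h; exact h

/-- `n₁ = 13179`. [this work] -/
theorem nParts_cexU9_one : nParts cexU9 1 = 13179 := by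
  rw [nParts_eq_sum_cnt]
  have h := congrArg (fun v => v.2.1) sum_cnt4_cexU9
  simp only [Prod.snd_sum, Prod.fst_sum] at h; exact h

/-- `n₂ = 450`. [this work] -/
theorem nParts_cexU9_two : nParts cexU9 2 = 450 := by
  rw [nParts_eq_sum_cnt]
  have h := congrArg (fun v => v.2.2.1) sum_cnt4_cexU9
  simp only [Prod.snd_sum, Prod.fst_sum] at h; exact h

/-- `n₃ = 6`. [this work] -/
theorem nParts_cexU9_three : nParts cexU9 3 = 6 := by
  rw [nParts_eq_sum_cnt]
  have h := congrArg (fun v => v.2.2.2) sum_cnt4_cexU9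
  simp only [Prod.snd_sum] at h; exact h

/-! ### 5. The refutations -/

/-- **REFUTATION: the tripartition ULC lemma-candidate is FALSE.**  For the monotone 9-point witness `cexU9` (twist `∅`)
`3·n₁·n₃ = 3·13179·6 = 237222 > 202500 = 450² = n₂²` — given `Z ∈ u`, the cells `X ∈ u` and `Y ∈ u` are positively correlated.
(The other inequality `3n₀n₂ ≤ n₁²` holds for this witness.) [this work] -/
theorem not_unateTripartitionULC : ¬ UnateTripartitionULC := by
  intro h
  -- (the values are substituted through fresh variables: unifying closed `nParts` terms directly would make the
  -- elaborator evaluate them)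
  have key : ∀ a b c : ℕ, 3 * a * c ≤ b ^ 2 → a = 13179 → b = 450 → c = 6 → False := by
    intro a b c habc ha hb hc; subst ha hb hc; norm_num at habc
  exact key _ _ _ (h 9 cexU9 ∅ cexU9_mono_symmDiff).2 nParts_cexU9_one nParts_cexU9_two nParts_cexU9_three

/-- **REFUTATION: the real-rootedness strengthening is FALSE** (a fortiori; directly: the discriminant of
`6048 + 13179t + 450t² + 6t³` is `−18131086461924 < 0`). [this work] -/
theorem not_unateTripartitionRealRooted : ¬ UnateTripartitionRealRooted := by
  intro h
  have h2 := h 9 cexU9 ∅ cexU9_mono_symmDiff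
  -- `simp only` matches with reducible transparency, so the closed `nParts` terms are not evaluated here
  simp only [nParts_cexU9_zero, nParts_cexU9_one, nParts_cexU9_two, nParts_cexU9_three] at h2
  norm_num at h2

end SahiTripartition

end Summit.CriticalPhenomena.PercolationContinuityZ3.Theorems
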